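import Summits.MatrixMultiplication.OmegaCensus.STPPSmallPatternKernelSearch122
import Summits.MatrixMultiplication.OmegaCensus.STPPSmallPatternKernelProduct

/-!
# ω-census, `(1,2,2)^4` is infeasible in `ℤ/2 × ℤ/14` — kernel search, part 5

HONEST FRAMING (pub-omega census; verbatim): lottery ticket; floor = certified bounds/negative ranges.
Census STRUCTURE bookkeeping of the STPP track (seat pub-omega-stpp-3, gen 24; STRUCTURE row B5, the threshold column
`T2(H) = max {k : (1,2,2)^k ⊆ H}`, lower side), not progress on `ω`: small patterns in small groups bound no exponent.

Chunks of `STPP122Neg.search2x (prodGC 2 (zcode 14)) 4` (`decide +kernel`, ≈ 141 s predicted;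
first-level codes reduced modulo the stabiliser of the representative in `Aut(ℤ/2 × ℤ/14)`);
assembled in `STPPSmallPatternNone122K4P2x14.lean`.

References: H. Cohn, R. Kleinberg, B. Szegedy, C. Umans, FOCS 2005 (arXiv:math/0511460), Def. 5.1.
-/

set_option Elab.async false  -- several kernel pieces: elaborate sequentially (memory)

namespace Summit.MatrixMultiplication.OmegaCensus

namespace STPP122Neg

open STPP211Neg

/-- Chunked kernel search, `ℤ/2 × ℤ/14`, `k = 4`, chunk `(y, x1)` = [(1, 268402687)]
(allowed `c'₀` codes [15]; ≈ 72 s predicted). -/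
theorem P2_14k4p.s8 : search2x (prodGC 2 (zcode 14)) 4 [(1, 268402687)] = true := by
  decide +kernel

/-- Chunked kernel search, `ℤ/2 × ℤ/14`, `k = 4`, chunk `(y, x1)` = [(1, 268369919)]
(allowed `c'₀` codes [16]; ≈ 70 s predicted). -/
theorem P2_14k4p.s9 : search2x (prodGC 2 (zcode 14)) 4 [(1, 268369919)] = true := by
  decide +kernel

end STPP122Neg

end Summit.MatrixMultiplication.OmegaCensus
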